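import Literature.Geometry.Kaehler.PoincareLemmaStarConvex
import Mathlib.Analysis.InnerProductSpace.PiL2
import HarnessLib

/-!
# The 1-jet of the radial homotopy primitive at its centre

Continuation of `Literature.Geometry.Kaehler.PoincareLemmaFlat` (the radial homotopy operator
`K = coneOperator x₀`, Bott–Tu (1982), §I.4) and
`Literature.Geometry.Kaehler.PoincareLemmaStarConvex` (its localisation by smooth cut-offs).
For a `2`-form `β` the cone primitive centred at `c` is the `1`-form
`K β x (v) = ∫₀¹ t β (c + t (x - c)) (x - c, v) dt`; replacing `β (c + t (x - c))` by `β c`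
gives its **1-jet at the centre**,
`K β x (v) = ½ β c (x - c, v) + O (‖x - c‖² ‖v‖)`,
with a constant controlled by a Lipschitz bound for `β` near `c`. We prove

* `abs_coneOperator_sub_half_le`: the pointwise estimate
  `|K β x (v) - ½ β c (x - c, v)| ≤ L ‖x - c‖² ‖v‖` for a continuous `β` satisfying
  `‖β (c + t (x - c)) - β c‖ ≤ L t ‖x - c‖` along the segment `[c, x]`;
* `exists_abs_coneOperator_sub_half_le`: for `β` of class `C^∞` on an open ball `B (c, ρ)` of
  a finite-dimensional space, a uniform constant on the closed half-ball (smooth cut-off to a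
  globally smooth form, a bound on its derivative over the compact convex closed half-ball, and
  the mean value inequality);
* `coneOperator_two_oneJet`: the same statement on `ℝ⁴ = EuclideanSpace ℝ (Fin 4)` (the form
  in which it is used for germs of symplectic forms on `4`-manifolds).

## References

* R. Bott, L. W. Tu, *Differential Forms in Algebraic Topology* (1982), §I.4 (the homotopy
  operator `K`).

Only the estimate at the centre of the cone construction is here; the homotopy formula and the
Poincaré lemma are in `PoincareLemmaFlat` / `PoincareLemmaStarConvex`.
-/

noncomputable section

open scoped Topology ContDiff Interval
open Set Filter MeasureTheory intervalIntegral ContinuousAlternatingMap Metric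

namespace Literature.Geometry.Kaehler

variable {E : Type*} [NormedAddCommGroup E] [NormedSpace ℝ E]

/-- `∫₀¹ t r dt = r / 2` (fundamental theorem of calculus for `t ↦ t² r / 2`). [folklore] -/
theorem integral_id_mul_const_zero_one (r : ℝ) : ∫ t in (0 : ℝ)..1, t * r = 2⁻¹ * r := by
  have h : ∀ t ∈ uIcc (0 : ℝ) 1,
      HasDerivAt (fun y : ℝ ↦ ((fun z : ℝ ↦ z) * fun z : ℝ ↦ z) y * (r / 2)) (t * r) t :=
    fun t _ ↦ (((hasDerivAt_id' t).mul (hasDerivAt_id' t)).mul_const (r / 2)).congr_deriv (by ring)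
  rw [integral_eq_sub_of_hasDerivAt h ((continuous_mul_const r).intervalIntegrable 0 1)]
  simp only [Pi.mul_apply]
  ring

/-- **Pointwise form of the 1-jet estimate for the cone primitive of a `2`-form.** If `β` is
continuous and satisfies `‖β (c + t (x - c)) - β c‖ ≤ L t ‖x - c‖` for `t ∈ [0, 1]`, with
`L ≥ 0`, then for every `v`, `|K β x (v) - ½ β c (x - c, v)| ≤ L ‖x - c‖² ‖v‖`. Proof:
`K β x (v) - ½ β c (x - c, v) = ∫₀¹ t (β (c + t (x - c)) - β c) (x - c, v) dt` (evaluation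
commutes with the integral, `∫₀¹ t dt = ½`), and the integrand is bounded by
`t · L t ‖x - c‖ · ‖x - c‖ ‖v‖ ≤ L ‖x - c‖² ‖v‖`. Bott–Tu (1982), §I.4 (the operator `K`).
[cite: BottTu1982Forms, §I.4] -/
theorem abs_coneOperator_sub_half_le {β : E → E [⋀^Fin 2]→L[ℝ] ℝ} (hβ : Continuous β)
    {c x : E} {L : ℝ} (hL : 0 ≤ L)
    (hb : ∀ t ∈ Icc (0 : ℝ) 1, ‖β (c + t • (x - c)) - β c‖ ≤ L * (t * ‖x - c‖)) (v : E) :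
    |coneOperator c β x ![v] - 2⁻¹ * β c ![x - c, v]| ≤ L * ‖x - c‖ ^ 2 * ‖v‖ := by
  have hi : IntervalIntegrable (fun t : ℝ ↦ coneIntegrand c β (t, x)) volume 0 1 :=
    (continuous_coneIntegrand_left c hβ x).intervalIntegrable 0 1
  have hg : ∀ t : ℝ, coneIntegrand c β (t, x) ![v] = t * β (c + t • (x - c)) ![x - c, v] := by
    intro t
    simp [coneIntegrand]
  have hgc : Continuous (fun t : ℝ ↦ t * β (c + t • (x - c)) ![x - c, v]) :=
    continuous_id.mul
      ((hβ.comp (continuous_const.add (continuous_id.smul continuous_const))).eval_const _)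
  rw [coneOperator, intervalIntegral_apply_alternating hi]
  simp only [hg]
  rw [← integral_id_mul_const_zero_one (β c ![x - c, v]),
    ← intervalIntegral.integral_sub (hgc.intervalIntegrable 0 1)
      ((continuous_mul_const (β c ![x - c, v])).intervalIntegrable 0 1)]
  have hbound : ∀ t ∈ Ι (0 : ℝ) 1,
      ‖t * β (c + t • (x - c)) ![x - c, v] - t * β c ![x - c, v]‖ ≤ L * ‖x - c‖ ^ 2 * ‖v‖ := by
    intro t ht
    rw [uIoc_of_le zero_le_one] at ht
    obtain ⟨ht0, ht1⟩ := ht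
    have hprod : ∏ i : Fin 2, ‖(![x - c, v] : Fin 2 → E) i‖ = ‖x - c‖ * ‖v‖ := by
      simp [Fin.prod_univ_two]
    have hA : ‖(β (c + t • (x - c)) - β c) ![x - c, v]‖ ≤
        L * (t * ‖x - c‖) * (‖x - c‖ * ‖v‖) := by
      refine (ContinuousAlternatingMap.le_opNorm _ _).trans ?_
      rw [hprod]
      exact mul_le_mul_of_nonneg_right (hb t ⟨ht0.le, ht1⟩) (by positivity)
    have hP : 0 ≤ L * ‖x - c‖ ^ 2 * ‖v‖ :=
      mul_nonneg (mul_nonneg hL (sq_nonneg _)) (norm_nonneg _)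
    rw [← mul_sub, norm_mul, Real.norm_eq_abs, abs_of_pos ht0,
      ← ContinuousAlternatingMap.sub_apply]
    calc t * ‖(β (c + t • (x - c)) - β c) ![x - c, v]‖
        ≤ t * (L * (t * ‖x - c‖) * (‖x - c‖ * ‖v‖)) := mul_le_mul_of_nonneg_left hA ht0.le
      _ = t ^ 2 * (L * ‖x - c‖ ^ 2 * ‖v‖) := by ring
      _ ≤ 1 * (L * ‖x - c‖ ^ 2 * ‖v‖) :=
        mul_le_mul_of_nonneg_right (pow_le_one₀ ht0.le ht1) hP
      _ = L * ‖x - c‖ ^ 2 * ‖v‖ := one_mul _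
  have h := intervalIntegral.norm_integral_le_of_norm_le_const hbound
  rw [sub_zero, abs_one, mul_one, Real.norm_eq_abs] at h
  exact h

/-- **The 1-jet of the cone primitive of a `2`-form at its centre** (finite-dimensional normed
space). If `β` is `C^∞` on the open ball `B (c, ρ)`, `ρ > 0`, there is `C` with
`|K β x (v) - ½ β c (x - c, v)| ≤ C ‖x - c‖² ‖v‖` for all `x` in the closed ball
`B̄ (c, ρ/2)` and all `v`. Proof: multiply `β` by a smooth cut-off equal to `1` near the closed
half-ball and to `0` near the complement of the open ball
(`exists_contDiff_one_nhdsSet_of_isCompact`) to get a globally `C^∞` form `β'` equal to `β` on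
the closed half-ball; `Dβ'` is bounded by some `M` on this compact set, so
`‖β' y - β' c‖ ≤ M ‖y - c‖` there by the mean value inequality on this convex set
(`Convex.norm_image_sub_le_of_norm_fderiv_le`); the segment `[c, x]` stays in the closed
half-ball, `K β x = K β' x` (`coneOperator_congr`), and `abs_coneOperator_sub_half_le` applies
with `C = M`. Bott–Tu (1982), §I.4 (the operator `K`). [cite: BottTu1982Forms, §I.4] -/
theorem exists_abs_coneOperator_sub_half_le [FiniteDimensional ℝ E]
    {β : E → E [⋀^Fin 2]→L[ℝ] ℝ} {c : E} {ρ : ℝ} (hρ : 0 < ρ)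
    (hβ : ContDiffOn ℝ ∞ β (ball c ρ)) :
    ∃ C : ℝ, ∀ x ∈ closedBall c (ρ / 2), ∀ v : E,
      |coneOperator c β x ![v] - 2⁻¹ * β c ![x - c, v]| ≤ C * ‖x - c‖ ^ 2 * ‖v‖ := by
  have hinf : (∞ : WithTop ℕ∞) ≠ 0 := by simp
  have hsub : closedBall c (ρ / 2) ⊆ ball c ρ := closedBall_subset_ball (by linarith)
  -- a globally smooth modification of `β` equal to `β` on the closed half-ball
  obtain ⟨ψ, hψ, h1, h0⟩ := exists_contDiff_one_nhdsSet_of_isCompact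
    (isCompact_closedBall c (ρ / 2)) isOpen_ball hsub
  set β' : E → E [⋀^Fin 2]→L[ℝ] ℝ := fun y ↦ ψ y • β y with hβ'def
  have hβ' : ContDiff ℝ ∞ β' := contDiff_smul_of_eventuallyEq_zero isOpen_ball hψ h0 hβ
  have heq : ∀ y ∈ closedBall c (ρ / 2), β' y = β y := fun y hy ↦ by
    rw [hβ'def]
    dsimp only
    rw [h1.self_of_nhdsSet y hy, one_smul]
  -- a bound on `Dβ'` over the compact closed half-ball and the mean value inequality
  obtain ⟨M, hM⟩ := (isCompact_closedBall c (ρ / 2)).exists_bound_of_continuousOn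
    ((hβ'.continuous_fderiv hinf).continuousOn (s := closedBall c (ρ / 2)))
  have hcK : c ∈ closedBall c (ρ / 2) := mem_closedBall_self (by linarith)
  have hM0 : 0 ≤ M := (norm_nonneg _).trans (hM c hcK)
  have hlip : ∀ y ∈ closedBall c (ρ / 2), ‖β' y - β' c‖ ≤ M * ‖y - c‖ := fun y hy ↦
    (convex_closedBall c (ρ / 2)).norm_image_sub_le_of_norm_fderiv_le
      (fun z _ ↦ hβ'.differentiable hinf z) hM hcK hy
  refine ⟨M, fun x hx v ↦ ?_⟩
  have hmem : ∀ t ∈ Icc (0 : ℝ) 1, c + t • (x - c) ∈ closedBall c (ρ / 2) := by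
    intro t ht
    rw [mem_closedBall, dist_eq_norm] at hx ⊢
    rw [add_sub_cancel_left, norm_smul, Real.norm_eq_abs, abs_of_nonneg ht.1]
    calc t * ‖x - c‖ ≤ 1 * ‖x - c‖ := mul_le_mul_of_nonneg_right ht.2 (norm_nonneg _)
      _ ≤ ρ / 2 := by rw [one_mul]; exact hx
  -- replace `β` by `β'` in the statement and conclude
  rw [coneOperator_congr c (β' := β') fun t ht ↦ (heq _ (hmem t ht)).symm, ← heq c hcK]
  refine abs_coneOperator_sub_half_le hβ'.continuous hM0 (fun t ht ↦ ?_) v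
  have h := hlip _ (hmem t ht)
  rwa [add_sub_cancel_left, norm_smul, Real.norm_eq_abs, abs_of_nonneg ht.1] at h

/-- **The 1-jet of the cone primitive of a `2`-form at its centre, on `ℝ⁴`.** For a `2`-form
`β` of class `C^∞` on the open ball `B (c, ρ)` of `EuclideanSpace ℝ (Fin 4)`, `ρ > 0`, there
is `C` with `|K β x (v) - ½ β c (x - c, v)| ≤ C ‖x - c‖² ‖v‖` for all `x ∈ B̄ (c, ρ/2)` and
all `v` (`exists_abs_coneOperator_sub_half_le` on `ℝ⁴`). Bott–Tu (1982), §I.4 (the operator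
`K`). [cite: BottTu1982Forms, §I.4] -/
theorem coneOperator_two_oneJet :
    ∀ (β : EuclideanSpace ℝ (Fin 4) → EuclideanSpace ℝ (Fin 4) [⋀^Fin 2]→L[ℝ] ℝ) (c : EuclideanSpace ℝ (Fin 4)) (ρ : ℝ), 0 < ρ → ContDiffOn ℝ ∞ β (Metric.ball c ρ) → ∃ C : ℝ, ∀ x ∈ Metric.closedBall c (ρ / 2), ∀ v : EuclideanSpace ℝ (Fin 4), |coneOperator c β x ![v] - 2⁻¹ * β c ![x - c, v]| ≤ C * ‖x - c‖ ^ 2 * ‖v‖ :=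
  fun _ _ _ hρ hβ ↦ exists_abs_coneOperator_sub_half_le hρ hβ

end Literature.Geometry.Kaehler
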